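import Summits.SmoothPoincare4.SmoothPoincare4.Theorems.AcyclicBisectionExists.Negative.Witness
import Literature.Geometry.Symplectic.SteinHandlebodies
import Literature.Geometry.Symplectic.SteinDomainComponents
import Literature.Topology.FourManifolds.LickorishWallaceProofs
import Literature.Topology.FourManifolds.HomotopyS4CompactProofs

/-!
# `PlanarBisectionExists` — support: the seam of ANY Stein bisection of a connected 4-manifold is
# connected (modulo Gompf 1998, Thm. 1.3 (a)); the `IsConnected` conjunct of the item is redundant

Support for the item
`Summit.SmoothPoincare4.SmoothPoincare4.Theses.ConvexBisection.PlanarBisectionExists`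
(stmt-SmoothPoincare4-10512).  The item asks for a Stein bisection `M = e₁ W₁ ∪ e₂ W₂` of every
homotopy 4-sphere along a common contact seam with planar `(∂W₁, ξ₁)` AND connected seam
`e₁ W₁ ∩ e₂ W₂`; the planner's complexity to be lowered by bypasses is
`c(Σ) = (support genus, b₁(Γ), #π₀ Γ)`.  This file shows that the last coordinate is idle for Stein
bisections: **over a connected `M`, the seam of every witness is connected**, modulo the tree's
named fact `Literature.Geometry.Symplectic.Gompf1998_thm13_indexLE_two` (Gompf 1998, Thm. 1.3 (a) /
Eliashberg 1990: a compact Stein domain is a 2-handlebody).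

* §1 `isPreconnected_boundary_inter_connectedComponent` — every connected component `C` of a
  compact Stein domain `W` has CONNECTED, NONEMPTY boundary `∂W ∩ C`: `C` is a 2-handlebody
  (the fact, restricted to the open submanifold `C`, tree `isHandlebodyOfIndexLE_opens`), so all
  critical points of an adapted Morse function have coindex `≥ 2` and the tree's
  `IsMorseAdapted.isPreconnected_boundary_and_nonempty` applies.
* §2 `exists_isClopen_half` — for one half `e : W → M` and closed sets `u, v` covering a set
  `s ⊇ e(∂W)` without common points in `s`: the points of `W` whose component has its boundary
  mapped into `u` form a clopen set, and the other components have their boundary mapped into `v`.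
* §3 `isConnected_seam_of_gompf` — **the seam of a witness over a connected `M` is connected**:
  otherwise split the seam by closed `u, v`; each half splits into the clopen unions of components
  of `u`-type and of `v`-type (§2), and the four images give a splitting of `M` into two disjoint
  nonempty closed sets (two images of different type can only meet on the seam, at a point lying
  in both `u` and `v`).  Corollary `planarBisectionExists_iff_of_gompf`: modulo the fact, the item
  is equivalent to its version WITHOUT the connectedness conjunct.
-/

noncomputable section

-- the prescribed namespace `Summit.<P>.<Sub>.…` duplicates `SmoothPoincare4` (P = Sub)
set_option linter.dupNamespace false

open scoped Manifold ContDiff Topology ContinuousMap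
open Set Function TopologicalSpace
open Literature.Geometry.Symplectic Literature.Topology.FourManifolds

namespace Summit.SmoothPoincare4.SmoothPoincare4.Theorems.PlanarBisectionExists

open Summit.SmoothPoincare4.SmoothPoincare4.Theses.ConvexBisection
open Summit.SmoothPoincare4.SmoothPoincare4.Theorems.AcyclicBisectionExists.Negative

/-! ## §1 Components of a compact Stein domain have connected nonempty boundary -/

section Components

variable {W : Type} [TopologicalSpace W] [T2Space W] [SecondCountableTopology W] [CompactSpace W]
  [ChartedSpace (EuclideanHalfSpace 4) W] [IsManifold (𝓡∂ 4) ∞ W]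

/-- **Every connected component of a compact Stein domain has connected, nonempty boundary**
(modulo Gompf 1998, Thm. 1.3 (a)): the component `C ∋ w` is an open submanifold, hence a
2-handlebody (`isHandlebodyOfIndexLE_opens`); its adapted Morse function has critical points of
coindex `≥ 2` only, so `∂C = ∂W ∩ C` is preconnected and nonempty
(`IsMorseAdapted.isPreconnected_boundary_and_nonempty`). [folklore] -/
theorem isPreconnected_boundary_inter_connectedComponent (hG : Gompf1998_thm13_indexLE_two)
    (S : SteinStructure W) (w : W) :
    IsPreconnected ((𝓡∂ 4).boundary W ∩ connectedComponent w) ∧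
      ((𝓡∂ 4).boundary W ∩ connectedComponent w).Nonempty := by
  have hW : IsHandlebodyOfIndexLE 3 2 W := hG W ⟨S⟩
  set U : Opens W := compOpens W (ConnectedComponents.mk w) with hUdef
  obtain ⟨f, hf, hidx⟩ := isHandlebodyOfIndexLE_opens U hW
  haveI : LocallyPathConnectedSpace U :=
    ChartedSpace.locallyPathConnectedSpace (EuclideanHalfSpace 4) U
  have key := hf.isPreconnected_boundary_and_nonempty (n := 3) fun y _ hy => by
    have := hidx y hy
    omega
  rw [ModelWithCorners.boundary_open] at key
  have hcoe : ((U : Opens W) : Set W) = connectedComponent w := coe_compOpens_mk w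
  constructor
  · have h := key.1.image (Subtype.val : U → W) continuous_subtype_val.continuousOn
    have hr : range (Subtype.val : U → W) = connectedComponent w := by
      rw [← hcoe]; exact Subtype.range_coe (s := (U : Set W))
    rwa [image_preimage_eq_inter_range, hr] at h
  · obtain ⟨y, hy⟩ := key.2
    exact ⟨y.1, hy, by rw [← hcoe]; exact y.2⟩

/-- The boundary of the component of `w`, mapped by a continuous `e : W → M`, is preconnected and
nonempty. [folklore] -/
theorem isPreconnected_image_boundary_inter_connectedComponent (hG : Gompf1998_thm13_indexLE_two)
    (S : SteinStructure W) {M : Type} [TopologicalSpace M] {e : W → M} (he : Continuous e) (w : W) :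
    IsPreconnected (e '' ((𝓡∂ 4).boundary W ∩ connectedComponent w)) ∧
      (e '' ((𝓡∂ 4).boundary W ∩ connectedComponent w)).Nonempty :=
  ⟨(isPreconnected_boundary_inter_connectedComponent hG S w).1.image e he.continuousOn,
    (isPreconnected_boundary_inter_connectedComponent hG S w).2.image e⟩

/-! ## §2 One half: the components of `u`-type form a clopen set -/

/-- **Sorting the components of one half.**  Let `e : W → M` be continuous, `s ⊇ e(∂W)`, and
`u, v` closed with `s ⊆ u ∪ v` and `s ∩ u ∩ v = ∅`.  Then the set `A` of points of `W` whose
component has its boundary mapped into `u` is clopen, and every point outside `A` has its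
component's boundary mapped into `v` (each such image is a preconnected nonempty subset of `s`,
§1). [folklore] -/
theorem exists_isClopen_half (hG : Gompf1998_thm13_indexLE_two) (S : SteinStructure W)
    {M : Type} [TopologicalSpace M] {e : W → M} (he : Continuous e) {s u v : Set M}
    (hs : e '' (𝓡∂ 4).boundary W ⊆ s) (hu : IsClosed u) (hv : IsClosed v) (hsuv : s ⊆ u ∪ v)
    (huv : s ∩ (u ∩ v) = ∅) :
    ∃ A : Set W, IsClopen A ∧
      (∀ w ∈ A, e '' ((𝓡∂ 4).boundary W ∩ connectedComponent w) ⊆ u) ∧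
      (∀ w ∉ A, e '' ((𝓡∂ 4).boundary W ∩ connectedComponent w) ⊆ v) := by
  haveI := locallyConnectedSpace_of_chartedSpace W
  -- the boundary image of the component of `w`
  set K : W → Set M := fun w => e '' ((𝓡∂ 4).boundary W ∩ connectedComponent w) with hK
  have hKs : ∀ w, K w ⊆ s := fun w =>
    (image_mono inter_subset_left).trans hs
  have hKuv : ∀ w, K w ⊆ u ∨ K w ⊆ v := fun w => by
    refine (isPreconnected_iff_subset_of_disjoint_closed.1
      (isPreconnected_image_boundary_inter_connectedComponent hG S he w).1) u v hu hv
      ((hKs w).trans hsuv) ?_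
    rw [← subset_empty_iff, ← huv]
    exact inter_subset_inter_left _ (hKs w)
  have hKne : ∀ w, (K w).Nonempty := fun w =>
    (isPreconnected_image_boundary_inter_connectedComponent hG S he w).2
  -- not both
  have hnot : ∀ w, K w ⊆ u → ¬ K w ⊆ v := fun w h1 h2 => by
    obtain ⟨p, hp⟩ := hKne w
    have : p ∈ s ∩ (u ∩ v) := ⟨hKs w hp, h1 hp, h2 hp⟩
    rw [huv] at this
    exact this
  -- `K` is constant on components
  have hKcomp : ∀ {w w' : W}, w' ∈ connectedComponent w → K w' = K w := fun h => by
    simp only [hK, connectedComponent_eq h]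
  refine ⟨{w | K w ⊆ u}, ⟨⟨?_⟩, ?_⟩, fun w hw => hw, fun w hw => (hKuv w).resolve_left hw⟩
  · -- the complement `{w | K w ⊆ v}` is open
    have hc : {w : W | K w ⊆ u}ᶜ = {w | K w ⊆ v} := by
      ext w
      simp only [mem_compl_iff, mem_setOf_eq]
      exact ⟨fun h => (hKuv w).resolve_left h, fun h h' => hnot w h' h⟩
    rw [hc, isOpen_iff_mem_nhds]
    intro w hw
    exact Filter.mem_of_superset (isOpen_connectedComponent.mem_nhds mem_connectedComponent)
      fun w' hw' => by simp only [mem_setOf_eq, hKcomp hw']; exact hw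
  · rw [isOpen_iff_mem_nhds]
    intro w hw
    exact Filter.mem_of_superset (isOpen_connectedComponent.mem_nhds mem_connectedComponent)
      fun w' hw' => by simp only [mem_setOf_eq, hKcomp hw']; exact hw

end Components

/-! ## §3 The seam of a witness over a connected `M` is connected -/

variable {M : Type} [TopologicalSpace M] [T2Space M] [SecondCountableTopology M]
  [ChartedSpace (EuclideanSpace ℝ (Fin 4)) M]

/-- **The seam of every Stein bisection of a connected 4-manifold is connected** (modulo Gompf
1998, Thm. 1.3 (a)).  If closed `u, v` split the seam `Γ`, sort the components of each half by
the type (`u` or `v`) of their boundary image (§2): the `u`-type images `e₁ A₁ ∪ e₂ A₂` and the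
`v`-type images form two closed sets covering `M`, both nonempty (a seam point of `u` lies on the
boundary of a `u`-type component), and disjoint — a common point of two images of the same half is
one point of one component (injectivity), and a common point of images of different halves is a
seam point lying in the boundary images of both components, hence in `u ∩ v ∩ Γ = ∅`.  This
contradicts the connectedness of `M`.  In particular both halves are "attached": the planner's
`#π₀ Γ` is always `1` for Stein bisections. [folklore] -/
theorem isConnected_seam_of_gompf (hG : Gompf1998_thm13_indexLE_two) [ConnectedSpace M]
    (B : Witness M) : IsConnected B.seam := by
  haveI := B.t2Space₁; haveI := B.t2Space₂
  haveI := B.secondCountableTopology₁; haveI := B.secondCountableTopology₂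
  refine ⟨B.seam_nonempty, isPreconnected_closed_iff.2 fun u v hu hv hsuv hsu hsv => ?_⟩
  by_contra hne
  rw [not_nonempty_iff_eq_empty] at hne
  -- sort the components of both halves
  obtain ⟨A₁, hA₁, hA₁u, hA₁v⟩ := exists_isClopen_half hG B.J₁ B.continuous_e₁
    (s := B.seam) (by rw [B.seam_eq_image₁]) hu hv hsuv hne
  obtain ⟨A₂, hA₂, hA₂u, hA₂v⟩ := exists_isClopen_half hG B.J₂ B.continuous_e₂
    (s := B.seam) (by rw [B.seam_eq_image₂]) hu hv hsuv hne
  -- the two closed pieces of `M`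
  set Mu : Set M := B.e₁ '' A₁ ∪ B.e₂ '' A₂ with hMu
  set Mv : Set M := B.e₁ '' A₁ᶜ ∪ B.e₂ '' A₂ᶜ with hMv
  have hMu_closed : IsClosed Mu :=
    ((hA₁.isClosed.isCompact.image B.continuous_e₁).isClosed).union
      ((hA₂.isClosed.isCompact.image B.continuous_e₂).isClosed)
  have hMv_closed : IsClosed Mv :=
    ((hA₁.compl.isClosed.isCompact.image B.continuous_e₁).isClosed).union
      ((hA₂.compl.isClosed.isCompact.image B.continuous_e₂).isClosed)
  have hcover : Mu ∪ Mv = univ := by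
    apply eq_univ_of_forall
    intro p
    have hp : p ∈ range B.e₁ ∪ range B.e₂ := by rw [B.cover]; exact mem_univ p
    rcases hp with ⟨w, rfl⟩ | ⟨w, rfl⟩
    · by_cases hw : w ∈ A₁
      · exact Or.inl (Or.inl ⟨w, hw, rfl⟩)
      · exact Or.inr (Or.inl ⟨w, hw, rfl⟩)
    · by_cases hw : w ∈ A₂
      · exact Or.inl (Or.inr ⟨w, hw, rfl⟩)
      · exact Or.inr (Or.inr ⟨w, hw, rfl⟩)
  -- a seam point seen from `W₁` lies in the boundary image of its component (and likewise `W₂`)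
  have hK₁ : ∀ {w₁ : B.W₁} {w₂ : B.W₂}, B.e₁ w₁ = B.e₂ w₂ →
      B.e₁ w₁ ∈ B.e₁ '' ((𝓡∂ 4).boundary B.W₁ ∩ connectedComponent w₁) := fun h =>
    ⟨_, ⟨(B.mem_boundary_of_eq h).1, mem_connectedComponent⟩, rfl⟩
  have hK₂ : ∀ {w₁ : B.W₁} {w₂ : B.W₂}, B.e₁ w₁ = B.e₂ w₂ →
      B.e₂ w₂ ∈ B.e₂ '' ((𝓡∂ 4).boundary B.W₂ ∩ connectedComponent w₂) := fun h =>
    ⟨_, ⟨(B.mem_boundary_of_eq h).2, mem_connectedComponent⟩, rfl⟩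
  have hseam : ∀ {w₁ : B.W₁} {w₂ : B.W₂}, B.e₁ w₁ = B.e₂ w₂ → B.e₁ w₁ ∈ B.seam := fun {w₁ w₂} h =>
    ⟨mem_range_self w₁, ⟨w₂, h.symm⟩⟩
  have habs : ∀ {p : M}, p ∈ B.seam → p ∈ u → p ∈ v → False := fun h1 h2 h3 => by
    have : _ ∈ B.seam ∩ (u ∩ v) := ⟨h1, h2, h3⟩
    rw [hne] at this
    exact this
  have hdisj : Mu ∩ Mv = ∅ := by
    apply eq_empty_of_forall_notMem
    rintro p ⟨hpu, hpv⟩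
    rcases hpu with ⟨w, hw, rfl⟩ | ⟨w, hw, rfl⟩ <;> rcases hpv with ⟨w', hw', h⟩ | ⟨w', hw', h⟩
    · exact hw' (B.injective_e₁ h ▸ hw)
    · exact habs (hseam h.symm) (hA₁u w hw (hK₁ h.symm)) (h ▸ hA₂v w' hw' (hK₂ h.symm))
    · exact habs (hseam h) (h.symm ▸ hA₂u w hw (hK₂ h)) (hA₁v w' hw' (hK₁ h))
    · exact hw' (B.injective_e₂ h ▸ hw)
  -- both pieces are nonempty
  have hMu_ne : Mu.Nonempty := by
    obtain ⟨p, hpS, hpu⟩ := hsu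
    have hp := hpS
    rw [B.seam_eq_image₁] at hp
    obtain ⟨w, hw, rfl⟩ := hp
    have hKw : B.e₁ w ∈ B.e₁ '' ((𝓡∂ 4).boundary B.W₁ ∩ connectedComponent w) :=
      ⟨w, ⟨hw, mem_connectedComponent⟩, rfl⟩
    by_cases hA : w ∈ A₁
    · exact ⟨_, Or.inl ⟨w, hA, rfl⟩⟩
    · exact (habs hpS hpu (hA₁v w hA hKw)).elim
  have hMv_ne : Mv.Nonempty := by
    obtain ⟨p, hpS, hpv⟩ := hsv
    have hp := hpS
    rw [B.seam_eq_image₁] at hp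
    obtain ⟨w, hw, rfl⟩ := hp
    have hKw : B.e₁ w ∈ B.e₁ '' ((𝓡∂ 4).boundary B.W₁ ∩ connectedComponent w) :=
      ⟨w, ⟨hw, mem_connectedComponent⟩, rfl⟩
    by_cases hA : w ∈ A₁
    · exact (habs hpS (hA₁u w hA hKw) hpv).elim
    · exact ⟨_, Or.inl ⟨w, hA, rfl⟩⟩
  -- contradiction with the connectedness of `M`
  have hcompl : Muᶜ = Mv := by
    apply Subset.antisymm
    · intro p hp
      have : p ∈ Mu ∪ Mv := by rw [hcover]; exact mem_univ p
      exact this.resolve_left hp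
    · intro p hp hp'
      have : p ∈ Mu ∩ Mv := ⟨hp', hp⟩
      rw [hdisj] at this
      exact this
  have hclopen : IsClopen Mu := ⟨hMu_closed, isClosed_compl_iff.1 (hcompl ▸ hMv_closed)⟩
  rcases isClopen_iff.1 hclopen with h0 | h1
  · exact hMu_ne.ne_empty h0
  · have : Mv = ∅ := by rw [← hcompl, h1, compl_univ]
    exact hMv_ne.ne_empty this

/-- **Over a homotopy 4-sphere, the seam of every witness is connected** (modulo Gompf 1998,
Thm. 1.3 (a)): `M ≃ₕ S⁴` is path connected. [folklore] -/
theorem isConnected_seam_of_homotopyEquiv (hG : Gompf1998_thm13_indexLE_two)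
    (e : M ≃ₕ (Metric.sphere (0 : EuclideanSpace ℝ (Fin 5)) 1)) (B : Witness M) :
    IsConnected B.seam := by
  haveI : PathConnectedSpace (Metric.sphere (0 : EuclideanSpace ℝ (Fin 5)) 1) :=
    pathConnectedSpace_sphere_four
  haveI : PathConnectedSpace M := pathConnectedSpace_of_homotopyEquiv e
  exact isConnected_seam_of_gompf hG B

/-- **The connectedness conjunct of the item is redundant** (modulo Gompf 1998, Thm. 1.3 (a)):
`PlanarBisectionExists ↔` every smooth `M ≃ₕ S⁴` carries a Stein bisection along a common contact
seam whose first half has planar contact boundary — with no condition on the seam. [folklore] -/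
theorem planarBisectionExists_iff_of_gompf (hG : Gompf1998_thm13_indexLE_two) :
    PlanarBisectionExists ↔
      ∀ (M : Type) [TopologicalSpace M] [T2Space M] [SecondCountableTopology M]
        [ChartedSpace (EuclideanSpace ℝ (Fin 4)) M] [IsManifold (𝓡 4) ∞ M],
        M ≃ₕ (Metric.sphere (0 : EuclideanSpace ℝ (Fin 5)) 1) →
          ∃ B : Witness M, PlanarContactBoundary B.J₁ := by
  constructor
  · intro h M _ _ _ _ _ f
    obtain ⟨W₁, _, _, _, _, W₂, _, _, _, _, J₁, J₂, e₁, e₂, h1, h2, h3, h4, h5, h6, h7, -⟩ :=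
      h M f
    exact ⟨⟨W₁, W₂, J₁, J₂, e₁, e₂, h1, h2, h3, h4, h5, h6⟩, h7⟩
  · intro h M _ _ _ _ _ f
    obtain ⟨B, hP⟩ := h M f
    exact ⟨B.W₁, inferInstance, inferInstance, inferInstance, inferInstance, B.W₂, inferInstance,
      inferInstance, inferInstance, inferInstance, B.J₁, B.J₂, B.e₁, B.e₂, B.emb₁, B.emb₂, B.cover,
      B.inter₁, B.inter₂, B.contact, hP, isConnected_seam_of_homotopyEquiv hG f B⟩

/-- **`SteinBisectionExists` already yields connected seams** (modulo Gompf 1998, Thm. 1.3 (a)):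
every Stein bisection along a common contact seam of a homotopy 4-sphere — in particular the one
provided by support item `SteinBisectionExists` (stmt-SmoothPoincare4-10509, Baykur 2006 Thm. 5.1)
— has connected seam; only PLANARITY separates the item from `SteinBisectionExists`. [folklore] -/
theorem steinBisectionExists_iff_connected_of_gompf (hG : Gompf1998_thm13_indexLE_two) :
    SteinBisectionExists ↔
      ∀ (M : Type) [TopologicalSpace M] [T2Space M] [SecondCountableTopology M]
        [ChartedSpace (EuclideanSpace ℝ (Fin 4)) M] [IsManifold (𝓡 4) ∞ M],
        M ≃ₕ (Metric.sphere (0 : EuclideanSpace ℝ (Fin 5)) 1) →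
          ∃ B : Witness M, IsConnected B.seam := by
  constructor
  · intro h M _ _ _ _ _ f
    obtain ⟨W₁, _, _, _, _, W₂, _, _, _, _, J₁, J₂, e₁, e₂, h1, h2, h3, h4, h5, h6⟩ := h M f
    exact ⟨⟨W₁, W₂, J₁, J₂, e₁, e₂, h1, h2, h3, h4, h5, h6⟩,
      isConnected_seam_of_homotopyEquiv hG f ⟨W₁, W₂, J₁, J₂, e₁, e₂, h1, h2, h3, h4, h5, h6⟩⟩
  · intro h M _ _ _ _ _ f
    obtain ⟨B, -⟩ := h M f
    exact ⟨B.W₁, inferInstance, inferInstance, inferInstance, inferInstance, B.W₂, inferInstance,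
      inferInstance, inferInstance, inferInstance, B.J₁, B.J₂, B.e₁, B.e₂, B.emb₁, B.emb₂, B.cover,
      B.inter₁, B.inter₂, B.contact⟩

end Summit.SmoothPoincare4.SmoothPoincare4.Theorems.PlanarBisectionExists
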